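import Mathlib
import Summits.KontsevichZagierPeriods.KontsevichZagierPeriods.Theses.SymplecticScissors
import Literature.NumberTheory.Transcendental.KZCalculusProofs
import Literature.NumberTheory.Transcendental.SemialgebraicMapsProofs

/-!
# `VolumeForm` (stmt-KontsevichZagierPeriods-3814), line `Sketch` — stub `stub_solidHatBox`

Archimedes' hat-box theorem as ONE change-of-variables generator of the Kontsevich–Zagier calculus
(`KZ.changeOfVariablesRel`, rule (2) of [Kontsevich–Zagier 2001, §1.2]). In cylindrical
coordinates the map `(ρ, θ, z) ↦ (ρ' = √(ρ² + z²), θ, z)` satisfies `ρ' dρ' = ρ dρ` at fixed `z`, so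
it preserves volume; it carries the open unit ball minus the `z`-axis
`{x² + y² + z² < 1, 0 < x² + y²}` (integrand `1`, the SOURCE `r`) onto the solid cylinder minus the
closed double cone `{z² < x² + y² < 1}` (integrand `1`, the TARGET `r'`), both of volume `4π / 3`.

The witness, in Cartesian coordinates: with the radial factor
`G p = ρ'/ρ = √((p₀² + p₁² + p₂²) / (p₀² + p₁²))` (positive and `ℚ`-semialgebraic on the source),
`Φ p = (p₀ G p, p₁ G p, p₂)`. Checked against the five fields of `changeOfVariablesRel`:
* semialgebraic: `G` is `√` of a quotient of `ℚ`-polynomials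
  (`isSemialgebraicFunOn_aeval_div_aeval`, `IsSemialgebraicFunOn.sqrt_holds`, `mul_holds`,
  `IsSemialgebraicMapOn.of_forall`);
* derivative: `Φ' p = [p₀ ∇G + G e₀; p₁ ∇G + G e₁; e₂]` with `∇G = ∇(G²) / (2G)` and
  `∇(G²) = (−2p₀p₂²/A², −2p₁p₂²/A², 2p₂/A)`, `A = p₀² + p₁²`; expanding along the last row,
  `det Φ' = G² + (p₀ ∂₀G + p₁ ∂₁G) G = G² − p₂²/A = 1`;
* injective: `Φ p = Φ q` forces `p₂ = q₂`, `|Φ p|² = p₀² + p₁² + p₂²` forces `A p = A q`, hence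
  `G p = G q > 0` and `p = q`;
* image: `(Φ p)₀² + (Φ p)₁² = p₀² + p₁² + p₂² ∈ (p₂², 1)`; conversely `q` with `q₂² < A' < 1`
  (`A' = q₀² + q₁²`) is `Φ (q₀ c, q₁ c, q₂)` with `c = √((A' − q₂²)/A')`;
* integrands: `1 = 1 · |1|`.

Sources: M. Kontsevich, D. Zagier, *Periods* (2001), §1.2 rule (2); Archimedes, *On the Sphere and
Cylinder* I (the hat-box theorem); the rest is calculus bookkeeping (folklore).
-/

noncomputable section

open Set MeasureTheory MvPolynomial
open Literature.NumberTheory.Transcendental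

namespace Summit.KontsevichZagierPeriods.SymplecticScissors.VolumeForm

open ContinuousLinearMap (proj)

/-- The coordinate function `p ↦ p i` on `ℝ³` has derivative the projection `proj i`.
[folklore] -/
theorem hatBox_hasFDerivAt_apply (i : Fin 3) (x : Fin 3 → ℝ) :
    HasFDerivAt (fun p : Fin 3 → ℝ => p i) (proj (R := ℝ) (φ := fun _ : Fin 3 => ℝ) i) x :=
  hasFDerivAt_apply i x

/-- Derivative of `A p = p₀² + p₁²` on `ℝ³`: `2p₀ e₀* + 2p₁ e₁*`. [folklore] -/
theorem hatBox_hasFDerivAt_sqSum2 (x : Fin 3 → ℝ) :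
    HasFDerivAt (fun p : Fin 3 → ℝ => p 0 ^ 2 + p 1 ^ 2)
      ((2 * x 0) • proj (R := ℝ) (φ := fun _ : Fin 3 => ℝ) 0 +
        (2 * x 1) • proj (R := ℝ) (φ := fun _ : Fin 3 => ℝ) 1) x := by
  refine (((hatBox_hasFDerivAt_apply 0 x).pow 2).fun_add
    ((hatBox_hasFDerivAt_apply 1 x).pow 2)).congr_fderiv ?_
  ext v
  simp

/-- Derivative of `B p = p₀² + p₁² + p₂²` on `ℝ³`: `2p₀ e₀* + 2p₁ e₁* + 2p₂ e₂*`. [folklore] -/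
theorem hatBox_hasFDerivAt_sqSum3 (x : Fin 3 → ℝ) :
    HasFDerivAt (fun p : Fin 3 → ℝ => p 0 ^ 2 + p 1 ^ 2 + p 2 ^ 2)
      ((2 * x 0) • proj (R := ℝ) (φ := fun _ : Fin 3 => ℝ) 0 +
        (2 * x 1) • proj (R := ℝ) (φ := fun _ : Fin 3 => ℝ) 1 +
        (2 * x 2) • proj (R := ℝ) (φ := fun _ : Fin 3 => ℝ) 2) x := by
  refine ((hatBox_hasFDerivAt_sqSum2 x).fun_add
    ((hatBox_hasFDerivAt_apply 2 x).pow 2)).congr_fderiv ?_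
  ext v
  simp

/-- Gradient of the squared radial factor `G² = (p₀² + p₁² + p₂²) / (p₀² + p₁²)` off the `z`-axis:
`(−2p₀p₂²/A², −2p₁p₂²/A², 2p₂/A)` with `A = p₀² + p₁²`. [folklore] -/
theorem hatBox_hasFDerivAt_ratio (x : Fin 3 → ℝ) (hA : x 0 ^ 2 + x 1 ^ 2 ≠ 0) :
    HasFDerivAt (fun p : Fin 3 → ℝ => (p 0 ^ 2 + p 1 ^ 2 + p 2 ^ 2) / (p 0 ^ 2 + p 1 ^ 2))
      ((-(2 * x 0 * x 2 ^ 2) / (x 0 ^ 2 + x 1 ^ 2) ^ 2) •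
          proj (R := ℝ) (φ := fun _ : Fin 3 => ℝ) 0 +
        (-(2 * x 1 * x 2 ^ 2) / (x 0 ^ 2 + x 1 ^ 2) ^ 2) •
          proj (R := ℝ) (φ := fun _ : Fin 3 => ℝ) 1 +
        (2 * x 2 / (x 0 ^ 2 + x 1 ^ 2)) • proj (R := ℝ) (φ := fun _ : Fin 3 => ℝ) 2) x := by
  have hinv : HasFDerivAt (fun p : Fin 3 → ℝ => (p 0 ^ 2 + p 1 ^ 2)⁻¹) _ x :=
    (hasDerivAt_inv hA).comp_hasFDerivAt x (hatBox_hasFDerivAt_sqSum2 x)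
  have hmul := (hatBox_hasFDerivAt_sqSum3 x).fun_mul hinv
  have hfun : (fun p : Fin 3 → ℝ => (p 0 ^ 2 + p 1 ^ 2 + p 2 ^ 2) / (p 0 ^ 2 + p 1 ^ 2)) =
      fun p : Fin 3 → ℝ => (p 0 ^ 2 + p 1 ^ 2 + p 2 ^ 2) * (p 0 ^ 2 + p 1 ^ 2)⁻¹ :=
    funext fun p => div_eq_mul_inv _ _
  rw [hfun]
  refine hmul.congr_fderiv ?_
  ext v
  simp only [Fin.isValue, smul_add, neg_smul, smul_neg, _root_.add_apply, _root_.neg_apply,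
    _root_.smul_apply, ContinuousLinearMap.proj_apply, smul_eq_mul]
  field_simp
  ring

/-- **Archimedes' hat-box theorem as one change of variables** (stub `stub_solidHatBox` of the
`VolumeForm` skeleton, stmt-KontsevichZagierPeriods-3814). For representations `r` on the open unit
ball minus the `z`-axis and `r'` on the solid unit cylinder minus the closed double cone, both with
integrand `1` on their domains, `[r] − [r']` is one change-of-variables generator of the
Kontsevich–Zagier calculus, with witness `Φ p = (p₀ G p, p₁ G p, p₂)`,
`G p = √((p₀² + p₁² + p₂²) / (p₀² + p₁²))`, `|det Φ'| = 1`.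
[cite: KontsevichZagier2001, §1.2 rule (2)] -/
theorem stub_solidHatBox : ∀ (r r' : KZ.IntegralRep 3),
    r.domain = {p | p 0 ^ 2 + p 1 ^ 2 + p 2 ^ 2 < 1 ∧ 0 < p 0 ^ 2 + p 1 ^ 2} →
    r'.domain = {q | q 2 ^ 2 < q 0 ^ 2 + q 1 ^ 2 ∧ q 0 ^ 2 + q 1 ^ 2 < 1} →
    (∀ p ∈ r.domain, r.integrand p = 1) → (∀ q ∈ r'.domain, r'.integrand q = 1) →
    KZ.of r - KZ.of r' ∈ KZ.changeOfVariablesRel := by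
  intro r r' hr hr' hf hf'
  -- membership in the two domains, unfolded
  have memr : ∀ p, p ∈ r.domain ↔ (p 0 ^ 2 + p 1 ^ 2 + p 2 ^ 2 < 1 ∧ 0 < p 0 ^ 2 + p 1 ^ 2) :=
    fun p => by rw [hr]; rfl
  have memr' : ∀ q, q ∈ r'.domain ↔ (q 2 ^ 2 < q 0 ^ 2 + q 1 ^ 2 ∧ q 0 ^ 2 + q 1 ^ 2 < 1) :=
    fun q => by rw [hr']; rfl
  -- the radial factor `G = ρ'/ρ`, the witness `Φ`, the gradient `L` of `G²`, the Jacobian `Φ'`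
  let Pr : Fin 3 → (Fin 3 → ℝ) →L[ℝ] ℝ := fun i => proj (R := ℝ) (φ := fun _ : Fin 3 => ℝ) i
  let G : (Fin 3 → ℝ) → ℝ := fun p => √((p 0 ^ 2 + p 1 ^ 2 + p 2 ^ 2) / (p 0 ^ 2 + p 1 ^ 2))
  let Φ : (Fin 3 → ℝ) → (Fin 3 → ℝ) := fun p => ![p 0 * G p, p 1 * G p, p 2]
  let L : (Fin 3 → ℝ) → (Fin 3 → ℝ) →L[ℝ] ℝ := fun x =>
    (-(2 * x 0 * x 2 ^ 2) / (x 0 ^ 2 + x 1 ^ 2) ^ 2) • Pr 0 +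
      (-(2 * x 1 * x 2 ^ 2) / (x 0 ^ 2 + x 1 ^ 2) ^ 2) • Pr 1 +
      (2 * x 2 / (x 0 ^ 2 + x 1 ^ 2)) • Pr 2
  let Φ' : (Fin 3 → ℝ) → (Fin 3 → ℝ) →L[ℝ] (Fin 3 → ℝ) := fun x =>
    ContinuousLinearMap.pi ![x 0 • ((1 / (2 * G x)) • L x) + G x • Pr 0,
      x 1 • ((1 / (2 * G x)) • L x) + G x • Pr 1, Pr 2]
  have hΦ0 : ∀ p, Φ p 0 = p 0 * G p := fun p => rfl
  have hΦ1 : ∀ p, Φ p 1 = p 1 * G p := fun p => rfl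
  have hΦ2 : ∀ p, Φ p 2 = p 2 := fun p => rfl
  -- the radial factor is positive off the axis and `G² · A = B`
  have hGpos : ∀ p : Fin 3 → ℝ, 0 < p 0 ^ 2 + p 1 ^ 2 → 0 < G p := fun p hA =>
    Real.sqrt_pos.2 (by positivity)
  have hG2 : ∀ p : Fin 3 → ℝ, 0 < p 0 ^ 2 + p 1 ^ 2 →
      G p ^ 2 * (p 0 ^ 2 + p 1 ^ 2) = p 0 ^ 2 + p 1 ^ 2 + p 2 ^ 2 := fun p hA => by
    simp only [G]
    rw [Real.sq_sqrt (by positivity), div_mul_cancel₀ _ hA.ne']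
  have hnorm : ∀ p : Fin 3 → ℝ, 0 < p 0 ^ 2 + p 1 ^ 2 →
      Φ p 0 ^ 2 + Φ p 1 ^ 2 = p 0 ^ 2 + p 1 ^ 2 + p 2 ^ 2 := fun p hA => by
    rw [hΦ0, hΦ1, ← hG2 p hA]
    ring
  -- the Jacobian determinant is `1`
  have hdet : ∀ x : Fin 3 → ℝ, 0 < x 0 ^ 2 + x 1 ^ 2 → (Φ' x).det = 1 := by
    intro x hA
    have hGx : G x ≠ 0 := (hGpos x hA).ne'
    have hG2x := hG2 x hA
    simp only [ContinuousLinearMap.det]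
    rw [← LinearMap.det_toMatrix', Matrix.det_fin_three]
    simp only [Φ', L, Pr, Fin.isValue, one_div, mul_inv_rev, smul_add, ContinuousLinearMap.coe_pi,
      LinearMap.toMatrix'_apply, LinearMap.pi_apply, Matrix.cons_val_zero, Matrix.cons_val_one,
      Matrix.cons_val, ContinuousLinearMap.toLinearMap_add, ContinuousLinearMap.toLinearMap_smul,
      ContinuousLinearMap.coe_proj, LinearMap.add_apply, LinearMap.smul_apply, LinearMap.coe_proj,
      Function.eval, Pi.single_eq_same, smul_eq_mul, mul_one, ne_eq, one_ne_zero,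
      not_false_eq_true, Pi.single_eq_of_ne, mul_zero, add_zero, Fin.reduceEq, zero_ne_one,
      zero_add, sub_zero]
    calc _ = G x ^ 2 - x 2 ^ 2 / (x 0 ^ 2 + x 1 ^ 2) := by
          field_simp
          ring
      _ = 1 := by
          field_simp
          linear_combination hG2x
  -- `Φ` maps the source into the target
  have hmaps : ∀ p ∈ r.domain, Φ p ∈ r'.domain := by
    intro p hp
    obtain ⟨hB, hA⟩ := (memr p).1 hp
    rw [memr', hnorm p hA, hΦ2]
    exact ⟨by linarith, hB⟩
  -- `Φ` is onto the target: explicit preimage `(q₀ c, q₁ c, q₂)`, `c = √((A' − q₂²) / A')`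
  have hsurj : ∀ q ∈ r'.domain, ∃ p ∈ r.domain, Φ p = q := by
    intro q hq
    obtain ⟨hq2, hq1⟩ := (memr' q).1 hq
    have hA' : 0 < q 0 ^ 2 + q 1 ^ 2 := lt_of_le_of_lt (sq_nonneg _) hq2
    have hd : 0 < (q 0 ^ 2 + q 1 ^ 2 - q 2 ^ 2) / (q 0 ^ 2 + q 1 ^ 2) :=
      div_pos (sub_pos.2 hq2) hA'
    set c : ℝ := √((q 0 ^ 2 + q 1 ^ 2 - q 2 ^ 2) / (q 0 ^ 2 + q 1 ^ 2)) with hc_def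
    have hc : 0 < c := Real.sqrt_pos.2 hd
    have hc2 : c ^ 2 * (q 0 ^ 2 + q 1 ^ 2) = q 0 ^ 2 + q 1 ^ 2 - q 2 ^ 2 := by
      rw [hc_def, Real.sq_sqrt hd.le, div_mul_cancel₀ _ hA'.ne']
    have hAc : (q 0 * c) ^ 2 + (q 1 * c) ^ 2 = q 0 ^ 2 + q 1 ^ 2 - q 2 ^ 2 := by
      rw [← hc2]
      ring
    have hGc : G ![q 0 * c, q 1 * c, q 2] = c⁻¹ := by
      simp only [G, Fin.isValue, Matrix.cons_val_zero, Matrix.cons_val_one, Matrix.cons_val]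
      rw [hAc]
      have : (q 0 ^ 2 + q 1 ^ 2 - q 2 ^ 2 + q 2 ^ 2) / (q 0 ^ 2 + q 1 ^ 2 - q 2 ^ 2) = c⁻¹ ^ 2 := by
        have h0 : q 0 ^ 2 + q 1 ^ 2 - q 2 ^ 2 ≠ 0 := (sub_pos.2 hq2).ne'
        field_simp
        linear_combination hc2
      rw [this, Real.sqrt_sq (inv_nonneg.2 hc.le)]
    refine ⟨![q 0 * c, q 1 * c, q 2], ?_, ?_⟩
    · rw [memr]
      simp only [Fin.isValue, Matrix.cons_val_zero, Matrix.cons_val_one, Matrix.cons_val]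
      rw [hAc]
      exact ⟨by linarith, sub_pos.2 hq2⟩
    · funext i
      match i with
      | 0 => rw [hΦ0, hGc]; simp [hc.ne']
      | 1 => rw [hΦ1, hGc]; simp [hc.ne']
      | 2 => rw [hΦ2]; simp
  refine ⟨3, r, r', Φ, Φ', ?_, ?_, ?_, ?_, ?_, rfl⟩
  · -- `Φ` is `ℚ`-semialgebraic on the source
    have hs := r.isSemialgebraic_domain
    have hq : ∀ p ∈ r.domain, aeval p (X 0 ^ 2 + X 1 ^ 2 : MvPolynomial (Fin 3) ℚ) ≠ (0 : ℝ) := by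
      intro p hp
      simpa using ((memr p).1 hp).2.ne'
    have hGsa : IsSemialgebraicFunOn ℚ r.domain G :=
      (IsSemialgebraicFunOn.sqrt_holds (isSemialgebraicFunOn_aeval_div_aeval hs
        (X 0 ^ 2 + X 1 ^ 2 + X 2 ^ 2) (X 0 ^ 2 + X 1 ^ 2) hq)).congr fun p _ => by simp [G]
    refine IsSemialgebraicMapOn.of_forall hs fun j => ?_
    match j with
    | 0 =>
      exact (IsSemialgebraicFunOn.mul_holds (isSemialgebraicFunOn_aeval hs (X 0)) hGsa).congr
        fun p _ => by simp [hΦ0]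
    | 1 =>
      exact (IsSemialgebraicFunOn.mul_holds (isSemialgebraicFunOn_aeval hs (X 1)) hGsa).congr
        fun p _ => by simp [hΦ1]
    | 2 => exact (isSemialgebraicFunOn_aeval hs (X 2)).congr fun p _ => by simp [hΦ2]
  · -- differentiability within the source
    intro x hx
    obtain ⟨-, hA⟩ := (memr x).1 hx
    have hGd : HasFDerivAt G ((1 / (2 * G x)) • L x) x :=
      (hatBox_hasFDerivAt_ratio x hA.ne').sqrt (div_pos (by positivity) hA).ne'
    refine HasFDerivAt.hasFDerivWithinAt (hasFDerivAt_pi'' fun i => ?_)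
    match i with
    | 0 =>
      rw [ContinuousLinearMap.proj_pi]
      exact (hatBox_hasFDerivAt_apply 0 x).fun_mul hGd
    | 1 =>
      rw [ContinuousLinearMap.proj_pi]
      exact (hatBox_hasFDerivAt_apply 1 x).fun_mul hGd
    | 2 =>
      rw [ContinuousLinearMap.proj_pi]
      exact hatBox_hasFDerivAt_apply 2 x
  · -- injectivity on the source
    intro p hp q hq hpq
    obtain ⟨-, hAp⟩ := (memr p).1 hp
    obtain ⟨-, hAq⟩ := (memr q).1 hq
    have e0 : p 0 * G p = q 0 * G q := by rw [← hΦ0, ← hΦ0, hpq]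
    have e1 : p 1 * G p = q 1 * G q := by rw [← hΦ1, ← hΦ1, hpq]
    have e2 : p 2 = q 2 := by
      have h := congrFun hpq 2
      rwa [hΦ2, hΦ2] at h
    have eB : p 0 ^ 2 + p 1 ^ 2 + p 2 ^ 2 = q 0 ^ 2 + q 1 ^ 2 + q 2 ^ 2 := by
      rw [← hnorm p hAp, ← hnorm q hAq, hpq]
    have eA : p 0 ^ 2 + p 1 ^ 2 = q 0 ^ 2 + q 1 ^ 2 := by
      rw [e2] at eB
      linarith
    have eG : G p = G q := by
      simp only [G]
      rw [eA, e2]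
    have hGq : G q ≠ 0 := (hGpos q hAq).ne'
    rw [eG] at e0 e1
    have h0 : p 0 = q 0 := mul_right_cancel₀ hGq e0
    have h1 : p 1 = q 1 := mul_right_cancel₀ hGq e1
    funext i
    match i with
    | 0 => exact h0
    | 1 => exact h1
    | 2 => exact e2
  · -- the image is the target
    refine Subset.antisymm (fun q hq => ?_) ?_
    · obtain ⟨p, hp, hpq⟩ := hsurj q hq
      exact ⟨p, hp, hpq⟩
    · rintro _ ⟨p, hp, rfl⟩
      exact hmaps p hp
  · -- the integrands: `1 = 1 · |1|`
    intro x hx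
    rw [hf x hx, hf' _ (hmaps x hx), hdet x ((memr x).1 hx).2]
    norm_num

end Summit.KontsevichZagierPeriods.SymplecticScissors.VolumeForm

end
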